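import Summits.Ventures.PercRepro.Defs
import Summits.Ventures.PercRepro.Conditioning
import Summits.Ventures.PercRepro.Graph
import Summits.Ventures.PercRepro.FlipConcavity
import Summits.Ventures.PercRepro.Cell3
import Summits.Ventures.PercRepro.PairSumEquality
import Summits.Ventures.PercRepro.PairSumStrict

/-!
# The equality locus of the pair-sum inequality

`G.Separates m u v`: every open connection between `u` and `v` passes through `m`
(`∀ ω, u ↔ v → u ↔ m`; this includes the case that `u` and `v` lie in different components).

**Theorem (`MultiGraph.pair_sum_eq_iff`).**  For distinct marked vertices `a, b, c` and edge
probabilities `0 < p e < 1`, the pair-sum inequality `y₁ y₂ + y₁ y₃ + y₂ y₃ ≤ x z` is an equality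
iff one of `a, b, c` separates the other two.

* (⇐) is `pair_sum_eq_of_separates` applied to the components of the two non-separating vertices
  in `G - m` (`sideOf`), for each of the three possible separators (the two cases where the
  separator is `a` or `c` are reduced to the case `b` by the symmetry of the five events).
* (⇒) is `pair_sum_lt`: if no marked vertex separates the other two, all three pair partitions are
  realisable and the inequality is strict.
-/

namespace PercRepro

namespace MultiGraph

variable {V E : Type*} {G : MultiGraph V E}

/-! ### Separation and the components of `G - m` -/

/-- `G.Separates m u v`: every open connection between `u` and `v` passes through `m`. -/
def Separates (G : MultiGraph V E) (m u v : V) : Prop :=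
  ∀ ω : Config E, G.Conn ω u v → G.Conn ω u m

/-- A configuration avoids the vertex `m` if none of its open edges touches `m`. -/
def Avoids (G : MultiGraph V E) (ω : Config E) (m : V) : Prop :=
  ∀ e, ω e = true → G.fst e ≠ m ∧ G.snd e ≠ m

/-- The component of `u` in `G - m`: the vertices reachable from `u` by a configuration avoiding
`m`. -/
def sideOf (G : MultiGraph V E) (m u : V) : Set V :=
  {x | ∃ ω : Config E, G.Avoids ω m ∧ G.Conn ω u x}

/-- `u` lies on its own side of `m`. -/
theorem mem_sideOf_self (m u : V) : u ∈ G.sideOf m u :=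
  ⟨fun _ => false, fun _ h => absurd h Bool.false_ne_true, Conn.refl G _ u⟩

/-- `m` is not on the side of `m` seen from `u ≠ m`. -/
theorem notMem_sideOf {m u : V} (hum : u ≠ m) : m ∉ G.sideOf m u := by
  rintro ⟨ω, hω, h⟩
  exact hum (eq_of_conn_of_isolated hω h.symm)

/-- `m` is the only exit from its complementary component `sideOf m u`. -/
theorem sideOf_sideOf [DecidableEq E] {m u : V} (hum : u ≠ m) : G.SideOf (G.sideOf m u) m := by
  intro g hg
  -- `g` touches `X = sideOf m u`; extend the avoiding configuration by `g`
  have key : ∀ {x y : V}, x ∈ G.sideOf m u → ((G.fst g = x ∧ G.snd g = y) ∨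
      (G.fst g = y ∧ G.snd g = x)) → y ≠ m → y ∈ G.sideOf m u := by
    intro x y ⟨ω, hω, hux⟩ hend hym
    have hxm : x ≠ m := by
      rintro rfl
      exact notMem_sideOf hum ⟨ω, hω, hux⟩
    refine ⟨Function.update ω g true, ?_, ?_⟩
    · intro e he
      by_cases heg : e = g
      · subst heg
        rcases hend with ⟨h1, h2⟩ | ⟨h1, h2⟩
        · exact ⟨h1 ▸ hxm, h2 ▸ hym⟩
        · exact ⟨h1 ▸ hym, h2 ▸ hxm⟩
      · rw [Function.update_of_ne heg] at he
        exact hω e he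
    · exact (hux.mono (le_update_true ω g)).trans
        (Conn.of_openAdj ⟨g, by simp, hend⟩)
  rcases hg with hfst | hsnd
  · refine ⟨Or.inl hfst, ?_⟩
    by_cases h : G.snd g = m
    · exact Or.inr h
    · exact Or.inl (key hfst (Or.inl ⟨rfl, rfl⟩) h)
  · refine ⟨?_, Or.inl hsnd⟩
    by_cases h : G.fst g = m
    · exact Or.inr h
    · exact Or.inl (key hsnd (Or.inr ⟨rfl, rfl⟩) h)

/-- If `m` separates `u` from `v` (and `u ≠ m`), the components of `u` and `v` in `G - m` are
disjoint. -/
theorem disjoint_sideOf {m u v : V} (hum : u ≠ m) (hsep : G.Separates m u v) :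
    Disjoint (G.sideOf m u) (G.sideOf m v) := by
  rw [Set.disjoint_left]
  rintro x ⟨ω₁, hω₁, h₁⟩ ⟨ω₂, hω₂, h₂⟩
  have hω : G.Avoids (ω₁ ⊔ ω₂) m := by
    intro e he
    rw [sup_apply_eq_true_iff] at he
    rcases he with he | he
    · exact hω₁ e he
    · exact hω₂ e he
  have huv : G.Conn (ω₁ ⊔ ω₂) u v :=
    (h₁.mono le_sup_left).trans (h₂.mono le_sup_right).symm
  exact hum (eq_of_conn_of_isolated hω (hsep _ huv).symm)

/-! ### Symmetries of the five events -/

/-- The separation event is symmetric in the two vertices. -/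
theorem sepEvent_comm (u v : V) : G.sepEvent u v = G.sepEvent v u := by
  unfold sepEvent
  rw [connEvent_comm]

/-- `{a ↔ b} ∩ {b ↮ c} = {a ↔ b} ∩ {a ↮ c}`. -/
theorem connEvent_inter_sepEvent_right (a b c : V) :
    G.connEvent a b ∩ G.sepEvent b c = G.connEvent a b ∩ G.sepEvent a c := by
  ext ω
  simp only [Set.mem_inter_iff, mem_connEvent, mem_sepEvent]
  exact ⟨fun ⟨hab, hbc⟩ => ⟨hab, fun hac => hbc (hab.symm.trans hac)⟩,
    fun ⟨hab, hac⟩ => ⟨hab, fun hbc => hac (hab.trans hbc)⟩⟩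

/-- `{a ↔ b} ∩ {a ↔ c} = {a ↔ b} ∩ {b ↔ c}`. -/
theorem connEvent_inter_connEvent_right (a b c : V) :
    G.connEvent a b ∩ G.connEvent a c = G.connEvent a b ∩ G.connEvent b c := by
  ext ω
  simp only [Set.mem_inter_iff, mem_connEvent]
  exact ⟨fun ⟨hab, hac⟩ => ⟨hab, hab.symm.trans hac⟩, fun ⟨hab, hbc⟩ => ⟨hab, hab.trans hbc⟩⟩

/-- `{b ↔ c} ∩ {a ↮ c} = {b ↔ c} ∩ {a ↮ b}`. -/
theorem connEvent_inter_sepEvent_left (a b c : V) :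
    G.connEvent b c ∩ G.sepEvent a c = G.connEvent b c ∩ G.sepEvent a b := by
  ext ω
  simp only [Set.mem_inter_iff, mem_connEvent, mem_sepEvent]
  exact ⟨fun ⟨hbc, hac⟩ => ⟨hbc, fun hab => hac (hab.trans hbc)⟩,
    fun ⟨hbc, hab⟩ => ⟨hbc, fun hac => hab (hac.trans hbc.symm)⟩⟩

/-- `{a ↔ c} ∩ {b ↔ c} = {a ↔ b} ∩ {b ↔ c}`. -/
theorem connEvent_inter_connEvent_left (a b c : V) :
    G.connEvent a c ∩ G.connEvent b c = G.connEvent a b ∩ G.connEvent b c := by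
  ext ω
  simp only [Set.mem_inter_iff, mem_connEvent]
  exact ⟨fun ⟨hac, hbc⟩ => ⟨hac.trans hbc.symm, hbc⟩, fun ⟨hab, hbc⟩ => ⟨hab.trans hbc, hbc⟩⟩

/-! ### The equality locus -/

section Main

variable [Fintype E] [DecidableEq E]

/-- Equality when `b` separates `a` from `c`. -/
theorem pair_sum_eq_of_separates_b {p : E → ℝ} (hp : IsProb p) (G : MultiGraph V E) (a b c : V)
    (hab : a ≠ b) (hcb : c ≠ b) (hsep : G.Separates b a c) :
    prob p (G.connEvent a b ∩ G.sepEvent a c) * prob p (G.connEvent a c ∩ G.sepEvent a b)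
      + prob p (G.connEvent a b ∩ G.sepEvent a c) * prob p (G.connEvent b c ∩ G.sepEvent a b)
      + prob p (G.connEvent a c ∩ G.sepEvent a b) * prob p (G.connEvent b c ∩ G.sepEvent a b)
      = prob p (G.connEvent a b ∩ G.connEvent b c)
          * prob p (G.sepEvent a b ∩ G.sepEvent a c ∩ G.sepEvent b c) :=
  pair_sum_eq_of_separates hp G a b c (mem_sideOf_self b a) (mem_sideOf_self b c)
    (notMem_sideOf hcb) (disjoint_sideOf hab hsep) (sideOf_sideOf hab) (sideOf_sideOf hcb)

/-- Equality when `a` separates `b` from `c`. -/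
theorem pair_sum_eq_of_separates_a {p : E → ℝ} (hp : IsProb p) (G : MultiGraph V E) (a b c : V)
    (hba : b ≠ a) (hca : c ≠ a) (hsep : G.Separates a b c) :
    prob p (G.connEvent a b ∩ G.sepEvent a c) * prob p (G.connEvent a c ∩ G.sepEvent a b)
      + prob p (G.connEvent a b ∩ G.sepEvent a c) * prob p (G.connEvent b c ∩ G.sepEvent a b)
      + prob p (G.connEvent a c ∩ G.sepEvent a b) * prob p (G.connEvent b c ∩ G.sepEvent a b)
      = prob p (G.connEvent a b ∩ G.connEvent b c)
          * prob p (G.sepEvent a b ∩ G.sepEvent a c ∩ G.sepEvent b c) := by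
  have h := pair_sum_eq_of_separates_b hp G b a c hba hca hsep
  rw [G.connEvent_comm b a, sepEvent_comm b a, connEvent_inter_sepEvent_right,
    connEvent_inter_connEvent_right, Set.inter_right_comm] at h
  linear_combination h

/-- Equality when `c` separates `a` from `b`. -/
theorem pair_sum_eq_of_separates_c {p : E → ℝ} (hp : IsProb p) (G : MultiGraph V E) (a b c : V)
    (hac : a ≠ c) (hbc : b ≠ c) (hsep : G.Separates c a b) :
    prob p (G.connEvent a b ∩ G.sepEvent a c) * prob p (G.connEvent a c ∩ G.sepEvent a b)
      + prob p (G.connEvent a b ∩ G.sepEvent a c) * prob p (G.connEvent b c ∩ G.sepEvent a b)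
      + prob p (G.connEvent a c ∩ G.sepEvent a b) * prob p (G.connEvent b c ∩ G.sepEvent a b)
      = prob p (G.connEvent a b ∩ G.connEvent b c)
          * prob p (G.sepEvent a b ∩ G.sepEvent a c ∩ G.sepEvent b c) := by
  have h := pair_sum_eq_of_separates_b hp G a c b hac hbc hsep
  rw [G.connEvent_comm c b, sepEvent_comm c b, connEvent_inter_sepEvent_left,
    connEvent_inter_connEvent_left, Set.inter_comm (G.sepEvent a c) (G.sepEvent a b)] at h
  linear_combination h

/-- **The equality locus of the pair-sum inequality.**  For distinct marked vertices `a, b, c` and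
edge probabilities `0 < p e < 1`:
`y₁ y₂ + y₁ y₃ + y₂ y₃ = x z` iff one of `a, b, c` separates the other two. -/
theorem pair_sum_eq_iff {p : E → ℝ} (hp : ∀ e, 0 < p e ∧ p e < 1) (G : MultiGraph V E)
    (a b c : V) (hab : a ≠ b) (hac : a ≠ c) (hbc : b ≠ c) :
    prob p (G.connEvent a b ∩ G.sepEvent a c) * prob p (G.connEvent a c ∩ G.sepEvent a b)
      + prob p (G.connEvent a b ∩ G.sepEvent a c) * prob p (G.connEvent b c ∩ G.sepEvent a b)
      + prob p (G.connEvent a c ∩ G.sepEvent a b) * prob p (G.connEvent b c ∩ G.sepEvent a b)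
      = prob p (G.connEvent a b ∩ G.connEvent b c)
          * prob p (G.sepEvent a b ∩ G.sepEvent a c ∩ G.sepEvent b c)
    ↔ G.Separates b a c ∨ G.Separates a b c ∨ G.Separates c a b := by
  have hp' : IsProb p := fun e => ⟨(hp e).1.le, (hp e).2.le⟩
  constructor
  · intro heq
    by_contra hnot
    obtain ⟨h1, h23⟩ := not_or.1 hnot
    obtain ⟨h2, h3⟩ := not_or.1 h23
    have hR : ∃ ω, G.Conn ω a c ∧ ¬ G.Conn ω a b := by
      obtain ⟨ω, hω⟩ := not_forall.1 h1
      exact ⟨ω, Classical.not_imp.1 hω⟩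
    have hS : ∃ ω, G.Conn ω b c ∧ ¬ G.Conn ω b a := by
      obtain ⟨ω, hω⟩ := not_forall.1 h2
      exact ⟨ω, Classical.not_imp.1 hω⟩
    have hP : ∃ ω, G.Conn ω a b ∧ ¬ G.Conn ω a c := by
      obtain ⟨ω, hω⟩ := not_forall.1 h3
      exact ⟨ω, Classical.not_imp.1 hω⟩
    exact absurd heq (ne_of_lt (pair_sum_lt hp G a b c hP hS hR))
  · rintro (h | h | h)
    · exact pair_sum_eq_of_separates_b hp' G a b c hab hbc.symm h
    · exact pair_sum_eq_of_separates_a hp' G a b c hab.symm hac.symm h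
    · exact pair_sum_eq_of_separates_c hp' G a b c hac hbc h

end Main

end MultiGraph

end PercRepro
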